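import Literature.Geometry.Kaehler.ComplexTorusHodge
import Literature.Geometry.Kaehler.ComplexTorusMaps
import HarnessLib

/-!
# Zucker's `J` on `ℂ²`: the operator `J(z, w) = (iz, -iw)`, anti-invariant `2`-forms, the form `dz ∧ dw̄`

Companion of `Literature/Geometry/Kaehler/ComplexTorusHodge.lean` (complex de Rham cohomology of
a complex torus = invariant forms, Lange–Birkenhake (1992), Prop. 1.1.20) and
`ComplexTorusMaps.lean` / `ComplexTorusForms.lean` (the homomorphisms `mapMatrix A` and the
pull-back of invariant forms). It supplies the linear algebra of S. Zucker, *The Hodge conjecture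
for cubic fourfolds*, Compositio Math. 34 (1977), Appendix B (pp. 207–208) for `n = 1`, used by
the barrier file `Literature/Barriers/HodgeConjecture/KaehlerCounterexamplesJTorus.lean`:

* `Zucker.J : ℂ² →L[ℂ] ℂ²`, `J(z, w) = (iz, -iw)` (p. 207), `J² = -1` (`Zucker.J_J`);
* a bilinear calculus for continuous alternating real `2`-forms with complex values
  (`Zucker.alt_swap`, `alt_add₀/₁`, `alt_smul₀/₁`, and on a complex line
  `c(ax, bx) = (Re a Im b - Im a Re b) c(x, ix)`, `Zucker.alt_line`);
* **anti-invariant forms are of type `(1,1)`** (`Zucker.isConstOfType_one_one`): if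
  `c(Ju, Ju') = -c(u, u')` for all `u, u' ∈ ℂ²` then `c` is `U(1)`-invariant, i.e.
  `ComplexTorus.IsConstOfType 1 1 c` — the `n = 1` case of Zucker's "`J^*ω = i^{2n}ω`" (p. 208:
  the `(-1)`-eigenspace of `J^*` on `Alt²_ℝ(V; ℂ)` is spanned by `dz ∧ dw̄`, `dz̄ ∧ dw`). Proof: the
  diagonal blocks of `c` on the two coordinate lines vanish (`J = ±i` there has real determinant
  `1`), the mixed blocks are invariant under `u ↦ iu`, and `i`-invariance gives `U(1)`-invariance;
* **Zucker's form `ω = dz ∧ dw̄`** (`Zucker.omega`, the Lemma p. 207 with `a = 1`), with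
  `J^*ω = -ω` (`Zucker.omega_J`) and `ω ≠ 0`;
* **`J`-lattices exist** (`Zucker.exists_jLattice`): a period isomorphism `Φ : ℝ⁴ ≃ ℂ²` and an
  integer matrix `A` with `Φ ∘ A = J ∘ Φ` (Zucker's "lattice `L` in `V` with `JL = L`", p. 207, in
  the tree's coordinates) — the square lattice `x ↦ (x₀ + ix₂, x₁ - ix₃)` (`Zucker.squarePeriod`,
  `Zucker.squareMatrix`).

NOT here (derived from these in the consumer file
`Literature/Barriers/HodgeConjecture/KaehlerCounterexamplesJTorus.lean`): for the torus
`T = ℂ²/Φ(ℤ^ι)` of a `J`-lattice, the action `[constForm c] ↦ [constForm (c ∘ J)]` of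
`mapMatrix A` on `H^k_dR(T; ℂ)`, `J^*J^* = id` on `H²_dR(T; ℂ)`, anti-invariant classes in
`H^{1,1}(T)`, and `J^* ≠ id` (via `ω`).

Mathlib (pinned) has continuous alternating maps (`vecCons_add`, `vecCons_smul`,
`AlternatingMap.map_swap`, `ContinuousMultilinearMap.alternatization`, `mkPiAlgebraFin`), used
here; it has no complex tori.

## References

* S. Zucker, Compositio Math. 34 (1977) 199–209, Appendix B, Lemma p. 207, Theorem p. 208.
  [Zucker1977]
* H. Lange, Ch. Birkenhake, *Complex Abelian Varieties* (1992), §1.1.2, §1.1.4, Prop. 1.1.20.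
  [LangeBirkenhake1992]
-/

noncomputable section

open scoped Manifold ContDiff Topology

universe u

namespace Literature.Geometry.Kaehler

open Literature.NumberTheory.Transcendental

namespace Zucker

/-! ### Bilinear calculus for continuous alternating real `2`-forms with complex values -/

open scoped ComplexConjugate

section Line

variable {E : Type u} [NormedAddCommGroup E] [NormedSpace ℂ E] (c : E [⋀^Fin 2]→L[ℝ] ℂ)

/-- Antisymmetry of an alternating `2`-form: `c(x, y) = -c(y, x)`. [folklore] -/
theorem alt_swap (x y : E) : c ![x, y] = -c ![y, x] := by
  have h := c.toAlternatingMap.map_swap ![y, x] (show (0 : Fin 2) ≠ 1 by decide)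
  have e : (![y, x] ∘ Equiv.swap (0 : Fin 2) 1) = ![x, y] := by
    funext i; fin_cases i <;> rfl
  rw [e] at h
  exact h

/-- An alternating `2`-form vanishes on the diagonal: `c(x, x) = 0`. [folklore] -/
theorem alt_self (x : E) : c ![x, x] = 0 :=
  c.map_eq_zero_of_eq ![x, x] (i := 0) (j := 1) rfl (by decide)

/-- Additivity in the first slot. [folklore] -/
theorem alt_add₀ (x x' y : E) : c ![x + x', y] = c ![x, y] + c ![x', y] :=
  c.vecCons_add ![y] x x'

/-- Real homogeneity in the first slot. [folklore] -/
theorem alt_smul₀ (r : ℝ) (x y : E) : c ![r • x, y] = r • c ![x, y] :=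
  c.vecCons_smul ![y] r x

/-- Additivity in the second slot. [folklore] -/
theorem alt_add₁ (x y y' : E) : c ![x, y + y'] = c ![x, y] + c ![x, y'] := by
  rw [alt_swap c x (y + y'), alt_add₀, neg_add, ← alt_swap, ← alt_swap]

/-- Real homogeneity in the second slot. [folklore] -/
theorem alt_smul₁ (r : ℝ) (x y : E) : c ![x, r • y] = r • c ![x, y] := by
  rw [alt_swap c x (r • y), alt_smul₀, ← smul_neg, ← alt_swap]

/-- `c(-x, y) = -c(x, y)`. [folklore] -/
theorem alt_neg₀ (x y : E) : c ![-x, y] = -c ![x, y] := by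
  rw [← neg_one_smul ℝ x, alt_smul₀, neg_one_smul]

/-- `c(x, -y) = -c(x, y)`. [folklore] -/
theorem alt_neg₁ (x y : E) : c ![x, -y] = -c ![x, y] := by
  rw [← neg_one_smul ℝ y, alt_smul₁, neg_one_smul]

/-- A complex multiple as a real combination of `x` and `ix`:
`a x = (Re a) x + (Im a)(ix)`. [folklore] -/
theorem complex_smul_eq (a : ℂ) (x : E) :
    a • x = (a.re : ℝ) • x + (a.im : ℝ) • (Complex.I • x) := by
  conv_lhs => rw [← Complex.re_add_im a]
  rw [add_smul, mul_smul, Complex.coe_smul, Complex.coe_smul]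

/-- **On a complex line an alternating real-bilinear form is a multiple of the area form**:
`c(ax, bx) = (Re a · Im b - Im a · Re b) c(x, ix)`. [folklore] -/
theorem alt_line (x : E) (a b : ℂ) :
    c ![a • x, b • x] = (a.re * b.im - a.im * b.re) • c ![x, Complex.I • x] := by
  rw [complex_smul_eq a x, complex_smul_eq b x]
  simp only [alt_add₀, alt_add₁, alt_smul₀, alt_smul₁, alt_self, smul_zero, zero_add, add_zero]
  rw [alt_swap c (Complex.I • x) x, smul_neg, smul_neg, ← neg_smul, smul_smul, smul_smul,
    ← add_smul]
  congr 1
  ring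

/-- Consequently `c(tax, tbx) = |t|² c(ax, bx)` on a complex line (the real determinant of
multiplication by `t` is `|t|²`). [folklore] -/
theorem alt_line_mul (x : E) (t a b : ℂ) :
    c ![(t * a) • x, (t * b) • x] = Complex.normSq t • c ![a • x, b • x] := by
  rw [alt_line, alt_line, smul_smul]
  congr 1
  simp only [Complex.mul_re, Complex.mul_im, Complex.normSq_apply]
  ring

/-- `z = -z` forces `z = 0` in `ℂ`. [folklore] -/
theorem eq_zero_of_eq_neg_self {z : ℂ} (h : z = -z) : z = 0 := by
  have h2 : (2 : ℂ) * z = 0 := by linear_combination h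
  simpa using h2

end Line

/-! ### Zucker's complex-linear operator `J(z, w) = (iz, -iw)` on `V = ℂ ⊕ ℂ` -/

/-- **Zucker's `J`** on `V = ℂⁿ ⊕ ℂⁿ` for `n = 1`: the `ℂ`-linear map `J(z, w) = (iz, -iw)` of
`V = ℂ²` (coordinates `0 ↔ z`, `1 ↔ w`). [cite: Zucker1977, Appendix B p. 207] -/
def J : (Fin 2 → ℂ) →L[ℂ] (Fin 2 → ℂ) where
  toFun u j := ![Complex.I, -Complex.I] j * u j
  map_add' u v := funext fun j ↦ mul_add _ _ _
  map_smul' a u := funext fun j ↦ by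
    simp only [Pi.smul_apply, smul_eq_mul, RingHom.id_apply]
    ring
  cont := continuous_pi fun j ↦ continuous_const.mul (continuous_apply j)

/-- Unfolding of `Zucker.J`: `(J u)ⱼ = (i, -i)ⱼ uⱼ`. [cite: Zucker1977, Appendix B p. 207] -/
@[simp] theorem J_apply (u : Fin 2 → ℂ) (j : Fin 2) :
    J u j = ![Complex.I, -Complex.I] j * u j := rfl

/-- `J² = -1`. [cite: Zucker1977, Appendix B p. 207] -/
theorem J_J (u : Fin 2 → ℂ) : J (J u) = -u := by
  funext j
  fin_cases j <;> simp <;> ring_nf <;> simp [Complex.I_sq]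

/-- `J` is multiplication by `i` on the `z`-line. [cite: Zucker1977, Appendix B p. 207] -/
theorem J_single_zero :
    J (Pi.single (0 : Fin 2) (1 : ℂ)) = Complex.I • Pi.single (0 : Fin 2) 1 := by
  funext j
  fin_cases j <;> simp

/-- `J` is multiplication by `-i` on the `w`-line. [cite: Zucker1977, Appendix B p. 207] -/
theorem J_single_one :
    J (Pi.single (1 : Fin 2) (1 : ℂ)) = -(Complex.I • Pi.single (1 : Fin 2) 1) := by
  funext j
  fin_cases j <;> simp

/-- Decomposition of a vector of `ℂ²` along the two coordinate lines. [folklore] -/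
theorem eq_smul_single_add (u : Fin 2 → ℂ) :
    u = u 0 • Pi.single (0 : Fin 2) (1 : ℂ) + u 1 • Pi.single (1 : Fin 2) (1 : ℂ) := by
  funext j
  fin_cases j <;> simp

/-! ### Anti-invariant `2`-forms are of type `(1, 1)` -/

section AntiInvariant

variable (c : (Fin 2 → ℂ) [⋀^Fin 2]→L[ℝ] ℂ)
  (hc : ∀ v : Fin 2 → (Fin 2 → ℂ), c (fun i ↦ J (v i)) = -c v)
include hc

/-- A `J`-anti-invariant form vanishes on the `z`-line (there `J = i`, of real determinant `1`).
[cite: Zucker1977, Appendix B p. 208] -/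
theorem diag₀_eq_zero (a a' : ℂ) :
    c ![a • Pi.single (0 : Fin 2) (1 : ℂ), a' • Pi.single (0 : Fin 2) (1 : ℂ)] = 0 := by
  have h := hc ![a • Pi.single 0 1, a' • Pi.single 0 1]
  have e : (fun i ↦ J (![a • Pi.single (0 : Fin 2) (1 : ℂ), a' • Pi.single 0 1] i)) =
      ![(Complex.I * a) • Pi.single (0 : Fin 2) (1 : ℂ), (Complex.I * a') • Pi.single 0 1] := by
    funext i; fin_cases i <;> simp [J_single_zero, smul_smul, mul_comm]
  rw [e, alt_line_mul, Complex.normSq_I, one_smul] at h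
  exact eq_zero_of_eq_neg_self h

/-- A `J`-anti-invariant form vanishes on the `w`-line (there `J = -i`).
[cite: Zucker1977, Appendix B p. 208] -/
theorem diag₁_eq_zero (b b' : ℂ) :
    c ![b • Pi.single (1 : Fin 2) (1 : ℂ), b' • Pi.single (1 : Fin 2) (1 : ℂ)] = 0 := by
  have h := hc ![b • Pi.single 1 1, b' • Pi.single 1 1]
  have e : (fun i ↦ J (![b • Pi.single (1 : Fin 2) (1 : ℂ), b' • Pi.single 1 1] i)) =
      ![(-Complex.I * b) • Pi.single (1 : Fin 2) (1 : ℂ), (-Complex.I * b') • Pi.single 1 1] := by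
    funext i; fin_cases i <;> simp [J_single_one, smul_smul, mul_comm]
  rw [e, alt_line_mul, Complex.normSq_neg, Complex.normSq_I, one_smul] at h
  exact eq_zero_of_eq_neg_self h

/-- The mixed `(z, w)`-block of a `J`-anti-invariant form is invariant under simultaneous
multiplication by `i`. [cite: Zucker1977, Appendix B p. 208] -/
theorem mixed₀₁ (a b : ℂ) :
    c ![(Complex.I * a) • Pi.single (0 : Fin 2) (1 : ℂ),
        (Complex.I * b) • Pi.single (1 : Fin 2) (1 : ℂ)] =
      c ![a • Pi.single (0 : Fin 2) (1 : ℂ), b • Pi.single (1 : Fin 2) (1 : ℂ)] := by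
  have h := hc ![a • Pi.single 0 1, b • Pi.single 1 1]
  have e : (fun i ↦ J (![a • Pi.single (0 : Fin 2) (1 : ℂ), b • Pi.single 1 1] i)) =
      ![(Complex.I * a) • Pi.single (0 : Fin 2) (1 : ℂ), -((Complex.I * b) • Pi.single 1 1)] := by
    funext i; fin_cases i <;> simp [J_single_zero, J_single_one, smul_smul, mul_comm]
  rw [e, alt_neg₁, neg_inj] at h
  exact h

/-- The mixed `(w, z)`-block of a `J`-anti-invariant form is invariant under simultaneous
multiplication by `i`. [cite: Zucker1977, Appendix B p. 208] -/
theorem mixed₁₀ (b a : ℂ) :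
    c ![(Complex.I * b) • Pi.single (1 : Fin 2) (1 : ℂ),
        (Complex.I * a) • Pi.single (0 : Fin 2) (1 : ℂ)] =
      c ![b • Pi.single (1 : Fin 2) (1 : ℂ), a • Pi.single (0 : Fin 2) (1 : ℂ)] := by
  have h := hc ![b • Pi.single 1 1, a • Pi.single 0 1]
  have e : (fun i ↦ J (![b • Pi.single (1 : Fin 2) (1 : ℂ), a • Pi.single 0 1] i)) =
      ![-((Complex.I * b) • Pi.single (1 : Fin 2) (1 : ℂ)), (Complex.I * a) • Pi.single 0 1] := by
    funext i; fin_cases i <;> simp [J_single_zero, J_single_one, smul_smul, mul_comm]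
  rw [e, alt_neg₀, neg_inj] at h
  exact h

/-- **A `J`-anti-invariant form is invariant under multiplication by `i`**: `c(iu, iu') = c(u, u')`
(sum of the four blocks). [cite: Zucker1977, Appendix B p. 208] -/
theorem iota_invariant (u u' : Fin 2 → ℂ) :
    c ![Complex.I • u, Complex.I • u'] = c ![u, u'] := by
  rw [eq_smul_single_add u, eq_smul_single_add u']
  simp only [smul_add, smul_smul, alt_add₀, alt_add₁, diag₀_eq_zero c hc, diag₁_eq_zero c hc,
    mixed₀₁ c hc, mixed₁₀ c hc]

omit hc in
/-- **Invariance under `i` implies invariance under `U(1)`**: if `c(iu, iu') = c(u, u')` then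
`c(e^{iθ}u, e^{iθ}u') = c(u, u')` (expand `e^{iθ} = cos θ + i sin θ`; the cross terms cancel by
`c(u, iu') + c(iu, u') = 0`). [folklore] -/
theorem u1_invariant (hι : ∀ u u' : Fin 2 → ℂ, c ![Complex.I • u, Complex.I • u'] = c ![u, u'])
    (θ : ℝ) (u u' : Fin 2 → ℂ) :
    c ![Complex.exp (θ * Complex.I) • u, Complex.exp (θ * Complex.I) • u'] = c ![u, u'] := by
  have hexp : ∀ w : Fin 2 → ℂ, Complex.exp (θ * Complex.I) • w =
      (Real.cos θ : ℝ) • w + (Real.sin θ : ℝ) • (Complex.I • w) := fun w ↦ by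
    rw [Complex.exp_mul_I, ← Complex.ofReal_cos, ← Complex.ofReal_sin, add_smul, mul_smul,
      Complex.coe_smul, Complex.coe_smul]
  have hcross : c ![Complex.I • u, u'] = -c ![u, Complex.I • u'] := by
    have h := hι u (Complex.I • u')
    rw [smul_smul, Complex.I_mul_I, neg_one_smul, alt_neg₁] at h
    rw [← h, neg_neg]
  have hsq : Real.sin θ * Real.sin θ = 1 - Real.cos θ * Real.cos θ := by
    nlinarith [Real.cos_sq_add_sin_sq θ]
  rw [hexp u, hexp u']
  simp only [alt_add₀, alt_add₁, alt_smul₀, alt_smul₁, hι u u', hcross, smul_add, smul_smul, hsq]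
  module

/-- **`J`-anti-invariant invariant `2`-forms are of type `(1, 1)`** (`ComplexTorus.IsConstOfType`):
for `n = 1` the `(-1)`-eigenspace of `J^*` on `Alt²_ℝ(V; ℂ)` is spanned by `dz ∧ dw̄`, `dz̄ ∧ dw`
(Zucker: `J^*ω = i^{2n} ω = -ω` for `ω = a dz ∧ dw̄`, `n` odd). [cite: Zucker1977, Appendix B p. 208] -/
theorem isConstOfType_one_one : ComplexTorus.IsConstOfType 1 1 c := by
  refine ⟨rfl, fun θ v ↦ ?_⟩
  have hv : v = ![v 0, v 1] := by funext i; fin_cases i <;> rfl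
  have e1 : (fun i ↦ Complex.exp (θ * Complex.I) • v i) =
      ![Complex.exp (θ * Complex.I) • v 0, Complex.exp (θ * Complex.I) • v 1] := by
    funext i; fin_cases i <;> rfl
  rw [e1, u1_invariant c (iota_invariant c hc) θ]
  conv_rhs => rw [hv]
  simp

end AntiInvariant

/-! ### Zucker's form `ω = dz ∧ dw̄` -/

/-- The real-bilinear map `(u, u') ↦ z(u) · \overline{w(u')}` on `V = ℂ²` (product of the
`ℝ`-linear functionals `z` and `w̄`). [cite: Zucker1977, Appendix B Lemma p. 207] -/
def omegaAux : ContinuousMultilinearMap ℝ (fun _ : Fin 2 ↦ (Fin 2 → ℂ)) ℂ :=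
  (ContinuousMultilinearMap.mkPiAlgebraFin ℝ 2 ℂ).compContinuousLinearMap fun i ↦
    ![(ContinuousLinearMap.proj (R := ℂ) (φ := fun _ : Fin 2 ↦ ℂ) 0).restrictScalars ℝ,
      Complex.conjCLE.toContinuousLinearMap.comp
        ((ContinuousLinearMap.proj (R := ℂ) (φ := fun _ : Fin 2 ↦ ℂ) 1).restrictScalars ℝ)] i

/-- `omegaAux (u, u') = z(u) \overline{w(u')}`. [cite: Zucker1977, Appendix B Lemma p. 207] -/
theorem omegaAux_apply (v : Fin 2 → (Fin 2 → ℂ)) : omegaAux v = v 0 0 * conj (v 1 1) := by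
  simp [omegaAux, ContinuousMultilinearMap.mkPiAlgebraFin_apply]

/-- **Zucker's `ω = dz ∧ dw̄`** (with `a = 1`): the alternation
`ω(u, u') = z(u)\overline{w(u')} - z(u')\overline{w(u)}` of `omegaAux`, a continuous alternating
real `2`-form on `V = ℂ²` with complex values. [cite: Zucker1977, Appendix B Lemma p. 207] -/
def omega : (Fin 2 → ℂ) [⋀^Fin 2]→L[ℝ] ℂ :=
  ContinuousMultilinearMap.alternatization omegaAux

/-- `omegaAux` is `J`-anti-invariant: `(iz)\overline{(-iw)} = -z w̄`.
[cite: Zucker1977, Appendix B p. 208] -/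
theorem omegaAux_J (w : Fin 2 → (Fin 2 → ℂ)) :
    omegaAux (fun i ↦ J (w i)) = -omegaAux w := by
  rw [omegaAux_apply, omegaAux_apply]
  simp
  ring_nf
  simp [Complex.I_sq]

/-- **`J^*ω = -ω`** (Zucker: `J^*ω = i^{2n} ω`, `n = 1`). [cite: Zucker1977, Appendix B p. 208] -/
theorem omega_J (v : Fin 2 → (Fin 2 → ℂ)) : omega (fun i ↦ J (v i)) = -omega v := by
  simp only [omega, ContinuousMultilinearMap.alternatization_apply_apply]
  rw [← Finset.sum_neg_distrib]
  refine Finset.sum_congr rfl fun σ _ ↦ ?_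
  rw [← smul_neg, ← omegaAux_J]
  rfl

/-- The two permutations of `Fin 2`. [folklore] -/
theorem perm_fin_two (σ : Equiv.Perm (Fin 2)) : σ = 1 ∨ σ = Equiv.swap 0 1 := by
  rcases Fin.exists_fin_two.mp ⟨σ 0, rfl⟩ with h | h
  · left
    have h1 : σ 1 = 1 := by
      have : σ 1 ≠ σ 0 := fun h' ↦ by simpa using σ.injective h'
      rw [h] at this
      exact Fin.eq_one_of_ne_zero _ this
    ext i
    fin_cases i <;> simp [h, h1]
  · right
    have h1 : σ 1 = 0 := by
      have : σ 1 ≠ σ 0 := fun h' ↦ by simpa using σ.injective h'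
      rw [h] at this
      revert this
      rcases Fin.exists_fin_two.mp ⟨σ 1, rfl⟩ with h' | h' <;> simp [h']
    ext i
    fin_cases i <;> simp [h, h1]

/-- `ω(e_z, e_w) = 1`: the form `ω` is not zero. [cite: Zucker1977, Appendix B Lemma p. 207] -/
theorem omega_single_single :
    omega ![Pi.single (0 : Fin 2) (1 : ℂ), Pi.single (1 : Fin 2) (1 : ℂ)] = 1 := by
  simp only [omega, ContinuousMultilinearMap.alternatization_apply_apply]
  rw [Finset.sum_eq_single (1 : Equiv.Perm (Fin 2))]
  · simp [omegaAux_apply]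
  · intro σ _ hσ
    rcases perm_fin_two σ with h | h
    · exact absurd h hσ
    · subst h
      simp [omegaAux_apply]
  · simp

/-- `ω ≠ 0`. [cite: Zucker1977, Appendix B Lemma p. 207] -/
theorem omega_ne_zero : omega ≠ 0 := fun h ↦ by
  have h1 := omega_single_single
  rw [h] at h1
  simp at h1

/-! ### `J`-lattices exist -/

/-- **The square `J`-lattice** `L = ℤv₁ ⊕ ℤv₂ ⊕ ℤJv₁ ⊕ ℤJv₂` with `v₁ = (1, 0)`, `v₂ = (0, 1)`, as a
period isomorphism `ℝ⁴ ≃ ℂ²`, `x ↦ (x₀ + i x₂, x₁ - i x₃)` (Zucker p. 207: "Choosing a basis for `L`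
of the form `{v₁, …, v₂ₙ, Jv₁, …, Jv₂ₙ}`"; here `n = 1` and the simplest choice of `v₁, v₂`).
[cite: Zucker1977, Appendix B p. 207] -/
def squarePeriod : (Fin 4 → ℝ) ≃ₗ[ℝ] (Fin 2 → ℂ) where
  toFun x := ![(x 0 : ℂ) + x 2 * Complex.I, (x 1 : ℂ) - x 3 * Complex.I]
  map_add' x y := by
    funext j; fin_cases j <;> (simp; ring)
  map_smul' r x := by
    funext j; fin_cases j <;> (simp [Complex.real_smul]; ring)
  invFun z := ![(z 0).re, (z 1).re, (z 0).im, -(z 1).im]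
  left_inv x := by
    funext j; fin_cases j <;> simp
  right_inv z := by
    funext j; fin_cases j <;> (apply Complex.ext <;> simp)

/-- The integer matrix of `J` in the lattice basis `v₁, v₂, Jv₁, Jv₂` (`Jv₁ ↦ -v₁`, …): the
block matrix `(0, -1; 1, 0)`. [cite: Zucker1977, Appendix B p. 207] -/
def squareMatrix : Matrix (Fin 4) (Fin 4) ℤ :=
  !![0, 0, -1, 0; 0, 0, 0, -1; 1, 0, 0, 0; 0, 1, 0, 0]

/-- **`J`-lattices exist** (the hypothesis `hA` of the statements above is not vacuous): the
square period isomorphism intertwines `squareMatrix` with `J`. (This particular torus is the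
self-product of the square elliptic curve, far from "general"; Zucker's theorem concerns general
`J`-lattices.) [cite: Zucker1977, Appendix B p. 207] -/
theorem exists_jLattice :
    ∃ (Φ : (Fin 4 → ℝ) ≃L[ℝ] (Fin 2 → ℂ)) (A : Matrix (Fin 4) (Fin 4) ℤ),
      ∀ x : Fin 4 → ℝ, Φ ((A.map (Int.cast : ℤ → ℝ)).mulVec x) = J (Φ x) := by
  refine ⟨squarePeriod.toContinuousLinearEquiv, squareMatrix, fun x ↦ ?_⟩
  change squarePeriod ((squareMatrix.map (Int.cast : ℤ → ℝ)).mulVec x) = J (squarePeriod x)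
  funext j
  fin_cases j <;>
    simp [squarePeriod, squareMatrix, Matrix.mulVec, dotProduct, Fin.sum_univ_four, Complex.ext_iff]

end Zucker

end Literature.Geometry.Kaehler

end
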